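import Mathlib
import HarnessLib
import Summits.Ventures.LatticeQCDFlow.Exactness.U1ExactForceWilson
import Summits.Ventures.LatticeQCDFlow.Exactness.U1WilsonFlowLOSubstep
import Summits.Ventures.LatticeQCDFlow.Exactness.SU2WilsonFlowLOMemberContinuity

/-!
# `U(1)` rung: the pulled-back action `β·S_W∘F − log J` of the LO Wilson-flow member is DIFFERENTIABLE along the drift — the engine's autodiff force through the member is a true derivative, not a junk `fderiv`

HONEST FRAMING: exact (Metropolis-corrected) sampling algorithms for lattice gauge theory;
figures of merit are autocorrelation/cost numbers at stated couplings and volumes; no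
continuum-physics claim.

Venture `LatticeQCDFlow` (cell pub-lqcd), topic `Exactness`; FANOUT row 14 (`eng-flowhmc`, `U(1)`
rung; FT-HMC force = autodiff of `S̃(e^(icp)·V)` at `p`, `S̃ = β S_W∘F − log J`, `F` the member).  NEW
WORK of the cell; nothing is cited as a fact; no number.  Every exact-force theorem of the cell is
stated with Mathlib's `fderiv`, which is the derivative where one exists and `0` otherwise;
`U1ExactForceWilson.differentiableAt_wilsonAction_circleDrift` settled differentiability for the
IDENTITY member.  Here: the LO member itself.

* `differentiableAt_coe_plaquetteHolonomy_of_links` — if every link of a `p`-dependent field is a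
  differentiable complex-valued function of `p` ("link-smooth"), so is every plaquette holonomy;
  `differentiableAt_wilsonAction_u1_of_links` — and so is `β·S_W`;
* `linkSmooth_u1WilsonFlowLOSubstep`, `differentiableAt_u1WilsonFlowLOJacobian_of_links` — a masked
  `U(1)` sub-step (formulas VERBATIM as in `exists_layers_u1WilsonFlowLO`) maps link-smooth fields to
  link-smooth fields, and its booked density along a link-smooth field is differentiable;
* **`linkSmooth_u1WilsonFlowLO_member`** — by induction over ANY schedule packaged as in
  `exists_layers_u1WilsonFlowLO`: the composite is link-smooth and the running log-det differentiable
  along every link-smooth field;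
* **`differentiableAt_ftAction_u1WilsonFlowLO_drift`** — hence, for positive booked densities (as the
  packaging provides), `p ↦ β S_W(F(e^(icp)·V)) − log J(e^(icp)·V)` is differentiable at EVERY `p`:
  the FT-HMC force the engine obtains by autodiff through the member is the Fréchet derivative that
  the cell's exact-force theorems speak about.

NOT CLAIMED: the `SU(2)` member (its typed formulas go through `angle`/`kickJac` case splits;
continuity is typed, differentiability is not); higher smoothness; any number.
-/

noncomputable section

namespace Summit.Ventures.LatticeQCDFlow.Exactness

open MeasureTheory
open Literature.MathematicalPhysics.QuantumFieldTheory Literature.MathematicalPhysics.QuantumLattice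

variable {d L : ℕ} {E : Type*} [NormedAddCommGroup E] [NormedSpace ℝ E]

/-! ## Link-smooth fields -/

section Links

/-- Plaquette holonomies of a link-smooth field are differentiable (complex-valued). -/
theorem differentiableAt_coe_plaquetteHolonomy_of_links (U : E → GaugeConfig d L Circle) (p₀ : E)
    (hU : ∀ e : Edge d L, DifferentiableAt ℝ (fun p : E => ((U p e : Circle) : ℂ)) p₀)
    (x : Site d L) (μ ν : Fin d) :
    DifferentiableAt ℝ (fun p : E => ((plaquetteHolonomy (U p) x μ ν : Circle) : ℂ)) p₀ := by
  have hconj : Differentiable ℝ (fun z : ℂ => (starRingEnd ℂ) z) := Complex.conjCLE.differentiable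
  simp only [plaquetteHolonomy, Circle.coe_mul, Circle.coe_inv_eq_conj]
  exact (((hU _).mul (hU _)).mul ((hconj.differentiableAt).comp p₀ (hU _))).mul
    ((hconj.differentiableAt).comp p₀ (hU _))

variable [NeZero L]

/-- `β·S_W` (defining representation) of a link-smooth field is differentiable. -/
theorem differentiableAt_wilsonAction_u1_of_links (β : ℝ) (U : E → GaugeConfig d L Circle) (p₀ : E)
    (hU : ∀ e : Edge d L, DifferentiableAt ℝ (fun p : E => ((U p e : Circle) : ℂ)) p₀) :
    DifferentiableAt ℝ (fun p : E => β * wilsonAction u1Rep (U p)) p₀ := by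
  have hhol := differentiableAt_coe_plaquetteHolonomy_of_links U p₀ hU
  unfold wilsonAction
  refine DifferentiableAt.const_mul ?_ β
  refine DifferentiableAt.fun_sum fun pl _ => ?_
  refine DifferentiableAt.const_sub ?_ _
  simp only [trace_u1Rep]
  exact Complex.reCLM.differentiableAt.comp p₀ (hhol pl.1 pl.2.1.1 pl.2.1.2)

end Links

/-! ## One masked sub-step -/

section Layer

variable {X : Type*} [DecidableEq X] (χ : Site d L → X)

/-- **A masked `U(1)` Wilson-flow sub-step maps link-smooth fields to link-smooth fields.** -/
theorem linkSmooth_u1WilsonFlowLOSubstep (μ : Fin d) (b : X) (ε : ℝ) (U : E → GaugeConfig d L Circle) (p₀ : E)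
    (hU : ∀ e : Edge d L, DifferentiableAt ℝ (fun p : E => ((U p e : Circle) : ℂ)) p₀) (e : Edge d L) :
    DifferentiableAt ℝ (fun p : E => (((fun (V : GaugeConfig d L Circle) (e : Edge d L) => if e.2 = μ ∧ χ e.1 = b then
          V e * Circle.exp (ε * ∑ ν ∈ Finset.univ.erase e.2,
            (((plaquetteHolonomy V (e.1 - Pi.single ν 1) e.2 ν : Circle) : ℂ).im -
              ((plaquetteHolonomy V e.1 e.2 ν : Circle) : ℂ).im)) else V e) (U p) e : Circle) : ℂ)) p₀ := by
  have hhol := differentiableAt_coe_plaquetteHolonomy_of_links U p₀ hU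
  by_cases he : e.2 = μ ∧ χ e.1 = b
  · simp only [if_pos he, Circle.coe_mul, Circle.coe_exp]
    have hZ : DifferentiableAt ℝ (fun p : E => ε * ∑ ν ∈ Finset.univ.erase e.2,
        (((plaquetteHolonomy (U p) (e.1 - Pi.single ν 1) e.2 ν : Circle) : ℂ).im -
          ((plaquetteHolonomy (U p) e.1 e.2 ν : Circle) : ℂ).im)) p₀ := by
      refine DifferentiableAt.const_mul ?_ ε
      refine DifferentiableAt.fun_sum fun ν _ => ?_
      exact (Complex.imCLM.differentiableAt.comp p₀ (hhol _ _ _)).sub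
        (Complex.imCLM.differentiableAt.comp p₀ (hhol _ _ _))
    have hC : DifferentiableAt ℝ (fun p : E => (((ε * ∑ ν ∈ Finset.univ.erase e.2,
        (((plaquetteHolonomy (U p) (e.1 - Pi.single ν 1) e.2 ν : Circle) : ℂ).im -
          ((plaquetteHolonomy (U p) e.1 e.2 ν : Circle) : ℂ).im) : ℝ)) : ℂ)) p₀ :=
      Complex.ofRealCLM.differentiableAt.comp p₀ hZ
    exact (hU e).mul (hC.mul_const Complex.I).cexp
  · simp only [if_neg he]
    exact hU e

variable [NeZero L]

/-- **The booked density of a masked `U(1)` sub-step along a link-smooth field is differentiable.** -/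
theorem differentiableAt_u1WilsonFlowLOJacobian_of_links (μ : Fin d) (b : X) (ε : ℝ) (U : E → GaugeConfig d L Circle) (p₀ : E)
    (hU : ∀ e : Edge d L, DifferentiableAt ℝ (fun p : E => ((U p e : Circle) : ℂ)) p₀) :
    DifferentiableAt ℝ (fun p : E => (fun V : GaugeConfig d L Circle => ∏ a : {e : Edge d L // e.2 = μ ∧ χ e.1 = b},
          (1 - ε * ∑ ν ∈ Finset.univ.erase a.1.2,
            (((plaquetteHolonomy V a.1.1 a.1.2 ν : Circle) : ℂ).re +
              ((plaquetteHolonomy V (a.1.1 - Pi.single ν 1) a.1.2 ν : Circle) : ℂ).re))) (U p)) p₀ := by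
  classical
  have hhol := differentiableAt_coe_plaquetteHolonomy_of_links U p₀ hU
  have hd : ∀ a : {e : Edge d L // e.2 = μ ∧ χ e.1 = b}, DifferentiableAt ℝ (fun p : E =>
      (1 - ε * ∑ ν ∈ Finset.univ.erase a.1.2,
        (((plaquetteHolonomy (U p) a.1.1 a.1.2 ν : Circle) : ℂ).re +
          ((plaquetteHolonomy (U p) (a.1.1 - Pi.single ν 1) a.1.2 ν : Circle) : ℂ).re))) p₀ := by
    intro a
    refine DifferentiableAt.const_sub ?_ _
    refine DifferentiableAt.const_mul ?_ ε
    refine DifferentiableAt.fun_sum fun ν _ => ?_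
    exact (Complex.reCLM.differentiableAt.comp p₀ (hhol _ _ _)).add
      (Complex.reCLM.differentiableAt.comp p₀ (hhol _ _ _))
  beta_reduce
  exact (HasFDerivAt.finsetProd (fun a _ => (hd a).hasFDerivAt)).differentiableAt

/-! ## The whole member, by induction over the schedule -/

/-- **The `U(1)` LO member maps link-smooth fields to link-smooth fields, with a differentiable
running log-det** — for ANY schedule and ANY `layers` packaged as in `exists_layers_u1WilsonFlowLO`. -/
theorem linkSmooth_u1WilsonFlowLO_member (ε : ℝ) (sched : List (Fin d × X)) (layers : List ((GaugeConfig d L Circle ≃ᵐ GaugeConfig d L Circle) × (GaugeConfig d L Circle → ℝ)))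
    (hmap :
      layers.map (fun Ly => ((Ly.1 : GaugeConfig d L Circle → GaugeConfig d L Circle), Ly.2)) = sched.map (fun s =>
        ((fun (V : GaugeConfig d L Circle) (e : Edge d L) => if e.2 = s.1 ∧ χ e.1 = s.2 then
          V e * Circle.exp (ε * ∑ ν ∈ Finset.univ.erase e.2,
            (((plaquetteHolonomy V (e.1 - Pi.single ν 1) e.2 ν : Circle) : ℂ).im -
              ((plaquetteHolonomy V e.1 e.2 ν : Circle) : ℂ).im)) else V e),
         fun V : GaugeConfig d L Circle => ∏ a : {e : Edge d L // e.2 = s.1 ∧ χ e.1 = s.2},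
          (1 - ε * ∑ ν ∈ Finset.univ.erase a.1.2,
            (((plaquetteHolonomy V a.1.1 a.1.2 ν : Circle) : ℂ).re +
              ((plaquetteHolonomy V (a.1.1 - Pi.single ν 1) a.1.2 ν : Circle) : ℂ).re)))))
    (U : E → GaugeConfig d L Circle) (p₀ : E)
    (hU : ∀ e : Edge d L, DifferentiableAt ℝ (fun p : E => ((U p e : Circle) : ℂ)) p₀) :
    (∀ e : Edge d L, DifferentiableAt ℝ (fun p : E => (((layers.foldr (fun Ly (F : GaugeConfig d L Circle ≃ᵐ GaugeConfig d L Circle) => Ly.1.trans F) (MeasurableEquiv.refl (GaugeConfig d L Circle))) (U p) e : Circle) : ℂ)) p₀) ∧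
    DifferentiableAt ℝ (fun p : E => (layers.foldr (fun Ly K => fun v => Ly.2 v * K (Ly.1 v)) (fun _ => (1 : ℝ))) (U p)) p₀ := by
  induction sched generalizing layers U with
  | nil =>
    have hnil : layers = [] := by
      have h := congrArg List.length hmap
      simp only [List.length_map, List.length_nil] at h
      exact List.eq_nil_of_length_eq_zero h
    subst hnil
    exact ⟨fun e => hU e, differentiableAt_const _⟩
  | cons s rest ih =>
    obtain ⟨Ly, layers', rfl⟩ : ∃ Ly layers', layers = Ly :: layers' := by
      cases layers with
      | nil => simp at hmap
      | cons Ly layers' => exact ⟨Ly, layers', rfl⟩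
    rw [List.map_cons, List.map_cons, List.cons.injEq] at hmap
    obtain ⟨hLy, hrest⟩ := hmap
    have hF : (Ly.1 : GaugeConfig d L Circle → GaugeConfig d L Circle) = (fun (V : GaugeConfig d L Circle) (e : Edge d L) => if e.2 = s.1 ∧ χ e.1 = s.2 then
          V e * Circle.exp (ε * ∑ ν ∈ Finset.univ.erase e.2,
            (((plaquetteHolonomy V (e.1 - Pi.single ν 1) e.2 ν : Circle) : ℂ).im -
              ((plaquetteHolonomy V e.1 e.2 ν : Circle) : ℂ).im)) else V e) := (Prod.mk.inj hLy).1
    have hJ : Ly.2 = fun V : GaugeConfig d L Circle => ∏ a : {e : Edge d L // e.2 = s.1 ∧ χ e.1 = s.2},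
          (1 - ε * ∑ ν ∈ Finset.univ.erase a.1.2,
            (((plaquetteHolonomy V a.1.1 a.1.2 ν : Circle) : ℂ).re +
              ((plaquetteHolonomy V (a.1.1 - Pi.single ν 1) a.1.2 ν : Circle) : ℂ).re)) := (Prod.mk.inj hLy).2
    -- the first layer keeps the field link-smooth
    have hU' : ∀ e : Edge d L, DifferentiableAt ℝ (fun p : E => ((Ly.1 (U p) e : Circle) : ℂ)) p₀ := by
      intro e
      rw [hF]
      exact linkSmooth_u1WilsonFlowLOSubstep χ s.1 s.2 ε U p₀ hU e
    obtain ⟨ihF, ihJ⟩ := ih layers' hrest (fun p => Ly.1 (U p)) hU'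
    refine ⟨fun e => ?_, ?_⟩
    · simp only [List.foldr_cons, MeasurableEquiv.coe_trans, Function.comp_apply]
      exact ihF e
    · simp only [List.foldr_cons]
      have hJ' : DifferentiableAt ℝ (fun p : E => Ly.2 (U p)) p₀ := by
        rw [hJ]
        exact differentiableAt_u1WilsonFlowLOJacobian_of_links χ s.1 s.2 ε U p₀ hU
      exact hJ'.mul ihJ

/-- **The pulled-back action of the `U(1)` LO member is differentiable along the drift, at every
momentum** (positive booked densities; `S = β·S_W`):  the autodiff force through the member is a true
derivative. -/
theorem differentiableAt_ftAction_u1WilsonFlowLO_drift (ε : ℝ) (sched : List (Fin d × X)) (layers : List ((GaugeConfig d L Circle ≃ᵐ GaugeConfig d L Circle) × (GaugeConfig d L Circle → ℝ)))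
    (hmap :
      layers.map (fun Ly => ((Ly.1 : GaugeConfig d L Circle → GaugeConfig d L Circle), Ly.2)) = sched.map (fun s =>
        ((fun (V : GaugeConfig d L Circle) (e : Edge d L) => if e.2 = s.1 ∧ χ e.1 = s.2 then
          V e * Circle.exp (ε * ∑ ν ∈ Finset.univ.erase e.2,
            (((plaquetteHolonomy V (e.1 - Pi.single ν 1) e.2 ν : Circle) : ℂ).im -
              ((plaquetteHolonomy V e.1 e.2 ν : Circle) : ℂ).im)) else V e),
         fun V : GaugeConfig d L Circle => ∏ a : {e : Edge d L // e.2 = s.1 ∧ χ e.1 = s.2},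
          (1 - ε * ∑ ν ∈ Finset.univ.erase a.1.2,
            (((plaquetteHolonomy V a.1.1 a.1.2 ν : Circle) : ℂ).re +
              ((plaquetteHolonomy V (a.1.1 - Pi.single ν 1) a.1.2 ν : Circle) : ℂ).re)))))
    (hpos : ∀ Ly ∈ layers, ∀ V, 0 < Ly.2 V) (β c : ℝ) (V : GaugeConfig d L Circle) (p₀ : (Edge d L → ℝ)) :
    DifferentiableAt ℝ (fun p : (Edge d L → ℝ) =>
      (fun W : GaugeConfig d L Circle => β * wilsonAction u1Rep ((layers.foldr (fun Ly (F : GaugeConfig d L Circle ≃ᵐ GaugeConfig d L Circle) => Ly.1.trans F) (MeasurableEquiv.refl (GaugeConfig d L Circle))) W) - Real.log ((layers.foldr (fun Ly K => fun v => Ly.2 v * K (Ly.1 v)) (fun _ => (1 : ℝ))) W)) ((fun i : Edge d L => Circle.exp (c * p i)) * V)) p₀ := by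
  have hU : ∀ e : Edge d L, DifferentiableAt ℝ (fun p : (Edge d L → ℝ) => ((((fun i : Edge d L => Circle.exp (c * p i)) * V) e : Circle) : ℂ)) p₀ :=
    fun e => differentiableAt_circleDrift_link c V e p₀
  obtain ⟨hF, hJ⟩ := linkSmooth_u1WilsonFlowLO_member χ ε sched layers hmap (fun p : (Edge d L → ℝ) => (fun i : Edge d L => Circle.exp (c * p i)) * V) p₀ hU
  beta_reduce
  refine (differentiableAt_wilsonAction_u1_of_links β _ p₀ hF).sub ?_
  exact hJ.log (foldr_logDet_pos layers hpos _).ne'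

end Layer

end Summit.Ventures.LatticeQCDFlow.Exactness
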